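import Summits.QuantumFields.BalabanUV.T4Continuum.Spine.NE3.PairLandauB8EndSfClassFrame
import Summits.QuantumFields.BalabanUV.T4Continuum.Spine.NE3.CovariantRoot
import Summits.QuantumFields.BalabanUV.T4Continuum.Support.NE7EtaBackgroundFlatStratumZero
import HarnessLib

/-!
# Route «BalabanUVNodes» (cluster K4 «SpineRates»), Track-A DAG node N16 = spine estimate NE3 «η-rate of Bałaban's constrained
# minimisers» — THE KNIT BY NAME: N16's statement of record at `d = 4` from the typed interfaces of its in-edges N05 ([B8]) and N07 ([B11])

Cell `pub-ymgap`, seat `pub-ymgap-dag-n16-a` (KNIT-BY-NAME, HUMAN RULING D-0062 «Track A at full width»; chair R424 venue, R429 «START HERE»;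
YM-PLAN v0.12.15 §2c row N16; `pub-balaban-gaps/BALABAN-GAPS.md` v1.0 §C rows NE3 ∕ NE3-R2; census `pub-balaban-gaps/ne/NE3.md` §§0–17 of the
row-NE3 seat `ne3`, gens 0–11).  `bears_on: R4∕N16`.  Filed `--supports stmt-QuantumFields-19351` (spine leaf `BalabanLadder.UV`) until the node
stub `S_N16` of route «BalabanUVNodes» (item stmt-QuantumFields-19182 `SpineGivenEndpoint`, K4) is an item.

WHAT N16 IS.  Statement of record (YM-PLAN §2c l.110; venue `HOME/lean/ym-dag/N16_NE3.lean` `YMDAG.N16`; dagwriter g77 `YMDAG.UVSplit.N16At`):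
`NE3EnergyWeightedCovShape.NE3EnergyRateWCov 4 (MinimalActionRate.sfClass 4 L N ε) L N b g C Λ₁ Λ₂' dom` — for every level `k ≥ 1`, datum `V ∈ dom`,
run-A minimiser `U_A` (k steps) and `(b, g)`-regular run-B minimiser `U_B` (k+1 steps) over Bałaban's everywhere-small-field class at `d = 4`
there are a unitary periodic gauge `u` and a skew periodic direction `Z` with `U_A^u = W·e^{Z}`, `W := rescale L (bavg L U_B)`, whose η-WEIGHTED
ENERGY is `≤ C·residualScale_k` and whose first ∕ second covariant differences are `≤ Λ₁ξ²` ∕ `≤ Λ₂′ξ³` (`ξ = L^{-k}`).  The abstract Literature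
root `T4EtaRateMin.NE3Shape` is recorded on the row without a slot (venue `N16shape`); this file knits the slot.

THE IN-EDGES AS TYPED (YM-PLAN §2c: «IN ← N07 ([B11] Prop. 6 p. 295 = R1^ϱ verbatim), N05»; the interfaces are the row-NE3 lineage's LANDED
hypothesis shapes, each located to its printed theorem — nothing is re-typed here):
* **N05 = [Balaban1985RegularSpaces] (B8) Thm 2 (1.36)–(1.39) pp. 82–83 WITH (1.37), READ AT THE MINIMISER PAIR** —
  `NE3.PairLandauB8Avg.PairLandauGaugeB8Avg 4 (sfClass 4 L N ε) L N b g s₁ s₂ 1 dom` (p341788; body `LandauRepB8Avg` = `LandauRepB8` (p340877) + `dbar`).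
  Gen 11 split it BY NAME (`NE3.PairFrameCondition.pairLandauGaugeB8Avg_iff_frame`, p397934): Thm 2's body `LandauRepB8` at every pair ∧ the
  STABILISER ∕ FRAME condition `V^{u_k⁻¹·v_k(relPert W Z)} = V` ([Balaban1985Averaging] (92)∕(97)) — §2 below displays both forms.
* **N07 = [Balaban1985Variational] (B11) Thm 1 (8)+(10) p. 279, sup-form regularity of the minimisers at every level** —
  `NE3.LeafIndexSockets.LeafH3sup 4 L N ε b′ c′ dom` (landed; the leaf (H3ˢᵘᵖ) of NE3's route (A)).  The ROSTER's «[B11] Prop. 6 p. 295 = R1^ϱ» names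
  the printed half of the v4 re-cut of NE3 (R1^ϱ = [B11] Sect. E (115)–(121) ∕ Prop. 6, the fixed-point ∕ Lipschitz-response TYPE; R2^ϱ = the
  unprinted core, GAPS row NE3-R2, PARKED inside the census §5 — the `-b` seat's hunt); on THE END of record the B11 in-edge enters as (H3ˢᵘᵖ)
  and through the hypotheses (1.33)∕(1.34) of B8 Thm 2 at the pair (regularity of `W` and `U_A` = [B11] Thm 1 (8)–(10) for the two runs).

THE KNIT = THE END OF RECORD AT `d = 4`.  `NE3.PairLandauB8EndSfClassHP.ne3EnergyRateWCov_sfClass_small_lineFree` (p396369 ✓; gens 2–10: junction,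
chart supplier, tangent-projection bound, Π-REG removal, both [B9]-§3 sup facts and the curved slice-Poincaré inequality PROVED on the lattice, every
numeric line discharged): for `L ≥ 2`, `N ≥ 1`, `g > 0` and leaf letters `(b′, c′)` on two level-free lines there is `r > 0` such that for
`0 < ε ≤ r`, `0 ≤ s₁ ≤ r`, `0 ≤ b ≤ ε∕2`:  N05-interface ∧ N07-interface ⟹ `∃ C, N16(L, N, ε, b, g, C, s₁, s₂, dom)`.

| conjunct of N16 | comes from | status |
|---|---|---|
| gauge `u`, direction `Z`, `U_A^u = W·e^Z` | `LandauRepB8.unitary∕periodic∕skew∕per∕rep` (B8 Thm 2, «exactly one gauge transformation u», (1.16)) | HYPOTHESIS (N05) |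
| (Lip₁ᶜ) `≤ Λ₁ξ²`, `Λ₁ = s₁` | `LandauRepB8.grad` = (1.36) second clause at `j = k` | HYPOTHESIS (N05), verbatim |
| (Lip₂′ᶜ) `≤ Λ₂′ξ³`, `Λ₂′ = s₂` | `LandauRepB8.holder` at `β = 1` = (1.36) third clause; **caveat (c2)**: B8 prints `β ≤ β₀ < 1`, B11 (9) prints `β = 1` underived | HYPOTHESIS (N05), verbatim |
| η-weighted ENERGY `≤ C·residualScale_k` | PROVED (ne3 gens 2–10) from `landau`∕`sup`∕`lap`∕`dbar` of N05 + (H3ˢᵘᵖ) of N07 | kernel |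

CONTENT (0 `def`, 0 `sorry`; bookkeeping over landed theorems BY NAME):
* §1 `n16_of_inEdges` — THE KNIT (discharge shape: in-edge interfaces ⟹ N16's record decl, `∃ C`).
* §2 `n16_of_inEdges_frame`, `n16_of_inEdges_frame_eq` — the same with N05 split into «B8 Thm 2's body `LandauRepB8` at every pair» ∧ the frame
  condition (resp. its (1.29)-type sufficient form `v_k(relPert W Z) = u_k`), gen 11.
* §3 VACUITY GUARD (referee A-audit): `leafLines_exists_four` (the two side lines hold for positive `(b′, c′)`); on the FLAT STRATUM
  `FS_N = {v N-periodic | ∃ w unitary, v = 1^{w}}` of the genuine class `sfClass 4 L N ε` (torons included) — `leafH3sup_flatStratum` (N07's interface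
  HOLDS), `pairLandauGaugeB8Avg_flatStratum` (N05's interface HOLDS, `Z = 0`, (1.37) by `dbavgCovIter_one_right`), `n16_flatStratum` (N16 HOLDS, by
  `NE7EtaBackgroundFlatStratum.covRoot_flatStratum`), `inEdges_inhabited_flatStratum` (the datum set is non-empty, minimisers EXIST at every level
  (`hmin_flatStratum`), and all three shapes hold there jointly) — so no binder of §1 is vacuous and the knit is not an ex-falso.
* §4 OUT-EDGE N16 → N19 by name: `closeness_of_n16` — N16's record decl is LITERALLY the hypothesis `hcov` of NE7 route #1's consumer
  `NE3.CovariantRoot.closeness_of_ne3EnergyRateWCov` (p339513).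

HONEST FRAMING.  Typing∕bookkeeping over LANDED theorems by name; nothing of Bałaban's is asserted; the two in-edge interfaces are HYPOTHESIS SHAPES
([B8] Thm 2 ∘ [B11] Thm 1 at the pairs, [B11] Thm 1 (8)+(10)) NOT proved on the concrete lattice (census rows R4∕R5, XL); **N16 ∕ NE3 is NOT
discharged** (discharged 0∕27 unchanged); NODE 00 has not pinned NE3's carriers `(L, N, ε, b, g, C, Λ₁, Λ₂′, dom)` (later stage; R422: parameters here);
one finite four-torus at fixed ε — NOT ℝ⁴, NOT infinite volume, NOT OS, NOT a mass gap, NOT Clay.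
-/

set_option autoImplicit false

open scoped BigOperators Matrix Matrix.Norms.L2Operator
open NormedSpace

namespace Summit.QuantumFields.YangMills.BalabanUVNodes.N16

open Literature.MathematicalPhysics.QuantumFieldTheory.Balaban1983to89
open B7Prop1Explicit B7Prop2Explicit
open T4AveragingDeficitWall (IsUnitaryCfg IsSkewDir Ad vary vary_zero_dir curl)
open T4AveragingDeficitWallBoundary (IsPeriodicCfg periodBox)
open B7AvgGaugeCovariance (uLev)
open B7Eq92Concrete (vcov)
open Summit.QuantumFields.BalabanUV.T4Continuum
open AveragingDeficitPeriodicCounting (IsPeriodicDir isPeriodicDir_zero)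
open AveragingDeficitDualResidual (dualC1 dualC2)
open AveragingDeficitDerivWallProof (wallConst)
open MinimalActionSandwich (IsMinimiser)
open MinimalActionRate (Regular sfClass)
open MinimalActionRefine (RegularSup)
open MinimalActionWitness (flatCfg)
open BlockAverageCurrent (curConst)
open NE3EnergyShapes (residualScale IsUnitarySite IsPeriodicSite)
open NE3EnergyWeightedShapes (energyNormW)
open NE3EnergyWeightedCovShape (NE3EnergyRateWCov)
open NE3RightInverseSupLetters (frameC)
open NE3.PairLandauB8 (LandauRepB8 isLandauB8_zero covLapDir_zero)
open NE3.PairLandauB8Avg (LandauRepB8Avg PairLandauGaugeB8Avg relPert relPert_zero dbavgCovIter_one_right)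
open NE3.LeafIndexSockets (LeafH3sup)
open NE3.PairLandauB8EndSfClassHP (ne3EnergyRateWCov_sfClass_small_lineFree)
open NE3.PairLandauB8EndSfClassFrame (ne3EnergyRateWCov_sfClass_small_lineFree_of_frame ne3EnergyRateWCov_sfClass_small_lineFree_of_frame_eq)
open NE3.PairLandauB8EndSfClassH3sup (leafLines_exists)
open NE3.CovariantRoot (closeness_of_ne3EnergyRateWCov)
open NE7EtaBackgroundFlatStratum (flatCfg_mem_flatStratum hmin_flatStratum exists_gauge_of_isMinimiser_flatStratum
  regularSup_gaugeAct_flatCfg_of_isPeriodicCfg covRoot_flatStratum)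
open NE7EtaBackgroundFlatStratumZero (exists_periodic_gauge_eq_rescale_bavg_flatStratum)

noncomputable section

variable {n : Type*} [Fintype n] [DecidableEq n]

/-! ## §1 THE KNIT: N05's interface ∧ N07's interface ⟹ N16 (statement of record, `∃ C`) -/

/-- **N16 · NE3 BY NAME FROM ITS IN-EDGES** (`d = 4`; block factor `L ≥ 2`, period `N ≥ 1`, regularity letter `g > 0`; leaf letters `0 ≤ b′, c′` on the
two level-free lines (Rb) `2¹⁵·5²·8²·L²·b′ ≤ 1` and `23040·4⁴·(frameC 4 L + 4)³·(c′ + curConst·b′²) ≤ 1`): there is `r > 0` such that for every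
class radius `0 < ε ≤ r`, B8 constant `0 ≤ s₁ ≤ r`, regularity `0 ≤ b ≤ ε∕2`, every `s₂` and every datum set `dom`,
`PairLandauGaugeB8Avg 4 (sfClass 4 L N ε) L N b g s₁ s₂ 1 dom` (N05: [B8] Thm 2 + (1.37) at the pair) and `LeafH3sup 4 L N ε b′ c′ dom`
(N07: [B11] Thm 1 (8)+(10)) imply `∃ C, NE3EnergyRateWCov 4 (sfClass 4 L N ε) L N b g C s₁ s₂ dom` = `YMDAG.N16 L N ε b g C s₁ s₂ dom`.
THE END of record `ne3EnergyRateWCov_sfClass_small_lineFree` at `d = 4`, nothing else. [folklore] -/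
theorem n16_of_inEdges [Nonempty n] {L N : ℕ} (hL : 2 ≤ L) (hN : 1 ≤ N) {g b' c' : ℝ} (hg : 0 < g) (hb' : 0 ≤ b') (hc' : 0 ≤ c')
    (hRb : 2 ^ 15 * ((4 : ℝ) + 1) ^ 2 * ((4 : ℝ) + 4) ^ 2 * (L : ℝ) ^ 2 * b' ≤ 1)
    (hcF : 23040 * (4 : ℝ) ^ 4 * (frameC 4 L + 4) ^ 3 * (c' + curConst 4 L * b' ^ 2) ≤ 1) :
    ∃ r : ℝ, 0 < r ∧ ∀ ⦃ε s₁ b : ℝ⦄, 0 < ε → ε ≤ r → 0 ≤ s₁ → s₁ ≤ r → 0 ≤ b → b ≤ ε / 2 →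
      ∀ (s₂ : ℝ) {dom : Set (Site 4 → Fin 4 → (Matrix n n ℂ)ˣ)},
        PairLandauGaugeB8Avg 4 (sfClass 4 L N ε) L N b g s₁ s₂ 1 dom →
        LeafH3sup 4 L N ε b' c' dom →
        ∃ C : ℝ, NE3EnergyRateWCov 4 (sfClass 4 L N ε) L N b g C s₁ s₂ dom := by
  haveI : NeZero L := NeZero.of_pos (by omega)
  haveI : NeZero N := NeZero.of_pos (by omega)
  exact ne3EnergyRateWCov_sfClass_small_lineFree (d := 4) (by norm_num) hL hN hg hb' hc'
    (by simpa only [Nat.cast_ofNat] using hRb) (by simpa only [Nat.cast_ofNat] using hcF)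

/-! ## §2 THE KNIT with N05 split by name: B8 Thm 2's body at every pair ∧ the frame condition -/

/-- **N16 BY NAME, N05 DISPLAYED AS «[B8] Thm 2's body `LandauRepB8` at every pair ∧ the STABILISER CONDITION `V^{u_k⁻¹·v_k(relPert W Z)} = V`»**
(same letters and lines as §1): THE END re-issued through `PairFrameCondition.pairLandauGaugeB8Avg_iff_frame` (gen 11, R49). [folklore] -/
theorem n16_of_inEdges_frame [Nonempty n] {L N : ℕ} (hL : 2 ≤ L) (hN : 1 ≤ N) {g b' c' : ℝ} (hg : 0 < g) (hb' : 0 ≤ b')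
    (hc' : 0 ≤ c') (hRb : 2 ^ 15 * ((4 : ℝ) + 1) ^ 2 * ((4 : ℝ) + 4) ^ 2 * (L : ℝ) ^ 2 * b' ≤ 1)
    (hcF : 23040 * (4 : ℝ) ^ 4 * (frameC 4 L + 4) ^ 3 * (c' + curConst 4 L * b' ^ 2) ≤ 1) :
    ∃ r : ℝ, 0 < r ∧ ∀ ⦃ε s₁ b : ℝ⦄, 0 < ε → ε ≤ r → 0 ≤ s₁ → s₁ ≤ r → 0 ≤ b → b ≤ ε / 2 →
      ∀ (s₂ : ℝ) {dom : Set (Site 4 → Fin 4 → (Matrix n n ℂ)ˣ)},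
        (∀ k : ℕ, 1 ≤ k → ∀ V ∈ dom, ∀ UA UB : Site 4 → Fin 4 → (Matrix n n ℂ)ˣ,
          IsMinimiser 4 (sfClass 4 L N ε) L N k V UA → IsMinimiser 4 (sfClass 4 L N ε) L N (k + 1) V UB → Regular 4 L N b g (k + 1) UB →
            ∃ (u : Site 4 → (Matrix n n ℂ)ˣ) (Z : Site 4 → Fin 4 → Matrix n n ℂ),
              LandauRepB8 L N k (rescale L (bavg L UB)) UA u Z s₁ s₂ 1 ∧
                gaugeAct (uLev L u⁻¹ k * vcov L (rescale L (bavg L UB)) (relPert (rescale L (bavg L UB)) Z) k) V = V) →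
        LeafH3sup 4 L N ε b' c' dom →
        ∃ C : ℝ, NE3EnergyRateWCov 4 (sfClass 4 L N ε) L N b g C s₁ s₂ dom := by
  haveI : NeZero L := NeZero.of_pos (by omega)
  haveI : NeZero N := NeZero.of_pos (by omega)
  exact ne3EnergyRateWCov_sfClass_small_lineFree_of_frame (d := 4) (by norm_num) hL hN hg hb' hc'
    (by simpa only [Nat.cast_ofNat] using hRb) (by simpa only [Nat.cast_ofNat] using hcF)

/-- **N16 BY NAME, N05 DISPLAYED WITH (1.37) IN ITS (1.29)-TYPE SUFFICIENT FORM `v_k(relPert W Z) = u_k`** (the accumulated frame (97) of the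
perturbation equals the corner values of the gauge; same letters and lines as §1). [folklore] -/
theorem n16_of_inEdges_frame_eq [Nonempty n] {L N : ℕ} (hL : 2 ≤ L) (hN : 1 ≤ N) {g b' c' : ℝ} (hg : 0 < g) (hb' : 0 ≤ b')
    (hc' : 0 ≤ c') (hRb : 2 ^ 15 * ((4 : ℝ) + 1) ^ 2 * ((4 : ℝ) + 4) ^ 2 * (L : ℝ) ^ 2 * b' ≤ 1)
    (hcF : 23040 * (4 : ℝ) ^ 4 * (frameC 4 L + 4) ^ 3 * (c' + curConst 4 L * b' ^ 2) ≤ 1) :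
    ∃ r : ℝ, 0 < r ∧ ∀ ⦃ε s₁ b : ℝ⦄, 0 < ε → ε ≤ r → 0 ≤ s₁ → s₁ ≤ r → 0 ≤ b → b ≤ ε / 2 →
      ∀ (s₂ : ℝ) {dom : Set (Site 4 → Fin 4 → (Matrix n n ℂ)ˣ)},
        (∀ k : ℕ, 1 ≤ k → ∀ V ∈ dom, ∀ UA UB : Site 4 → Fin 4 → (Matrix n n ℂ)ˣ,
          IsMinimiser 4 (sfClass 4 L N ε) L N k V UA → IsMinimiser 4 (sfClass 4 L N ε) L N (k + 1) V UB → Regular 4 L N b g (k + 1) UB →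
            ∃ (u : Site 4 → (Matrix n n ℂ)ˣ) (Z : Site 4 → Fin 4 → Matrix n n ℂ),
              LandauRepB8 L N k (rescale L (bavg L UB)) UA u Z s₁ s₂ 1 ∧
                vcov L (rescale L (bavg L UB)) (relPert (rescale L (bavg L UB)) Z) k = uLev L u k) →
        LeafH3sup 4 L N ε b' c' dom →
        ∃ C : ℝ, NE3EnergyRateWCov 4 (sfClass 4 L N ε) L N b g C s₁ s₂ dom := by
  haveI : NeZero L := NeZero.of_pos (by omega)
  haveI : NeZero N := NeZero.of_pos (by omega)
  exact ne3EnergyRateWCov_sfClass_small_lineFree_of_frame_eq (d := 4) (by norm_num) hL hN hg hb' hc'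
    (by simpa only [Nat.cast_ofNat] using hRb) (by simpa only [Nat.cast_ofNat] using hcF)

/-! ## §3 VACUITY GUARD: the side lines are satisfiable; on the flat stratum of `sfClass 4 L N ε` both in-edge interfaces AND N16 hold, with
minimisers existing at every level -/

/-- **THE TWO SIDE LINES OF §1 HOLD FOR SOME POSITIVE LEAF LETTERS `(b′, c′)`** (every `L`) — `PairLandauB8EndSfClassH3sup.leafLines_exists` at `d = 4`.
[folklore] -/
theorem leafLines_exists_four (L : ℕ) : ∃ b' c' : ℝ, 0 < b' ∧ 0 < c' ∧
    2 ^ 15 * ((4 : ℝ) + 1) ^ 2 * ((4 : ℝ) + 4) ^ 2 * (L : ℝ) ^ 2 * b' ≤ 1 ∧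
    23040 * (4 : ℝ) ^ 4 * (frameC 4 L + 4) ^ 3 * (c' + curConst 4 L * b' ^ 2) ≤ 1 := by
  simpa only [Nat.cast_ofNat] using leafLines_exists (d := 4) (by norm_num) L

/-- **N07's INTERFACE HOLDS ON THE FLAT STRATUM** (`L, N ≥ 1`, `ε, b′, c′ ≥ 0`): every minimiser over `sfClass 4 L N ε` of a flat `N`-periodic datum
`1^{w}` is a periodic pure gauge `1^{g}` (`exists_gauge_of_isMinimiser_flatStratum`), hence `RegularSup` (`regularSup_gaugeAct_flatCfg_of_isPeriodicCfg`).
[folklore] -/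
theorem leafH3sup_flatStratum [Nonempty n] {L N : ℕ} (hL : 1 ≤ L) (hN : 1 ≤ N) {ε b' c' : ℝ} (hε : 0 ≤ ε) (hb' : 0 ≤ b')
    (hc' : 0 ≤ c') :
    LeafH3sup 4 L N ε b' c'
      {v : Site 4 → Fin 4 → (Matrix n n ℂ)ˣ | IsPeriodicCfg v (N : ℤ) ∧ ∃ w : Site 4 → (Matrix n n ℂ)ˣ,
        IsUnitarySite w ∧ v = gaugeAct w flatCfg} := by
  rintro V ⟨hVP, w, hwu, rfl⟩ k U hU
  have hper : IsPeriodicCfg U ((N * L ^ (k + 1) : ℕ) : ℤ) := hU.mem.1.2.1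
  obtain ⟨g, hgu, hUg, -⟩ := exists_gauge_of_isMinimiser_flatStratum hL hN hε hwu hVP hU
  rw [hUg] at hper ⊢
  exact regularSup_gaugeAct_flatCfg_of_isPeriodicCfg hgu hper hb' hc'

/-- **N05's INTERFACE HOLDS ON THE FLAT STRATUM** (`L, N ≥ 1`, `ε, s₁, s₂ ≥ 0`, any `b, g, β`): at a minimiser pair of a flat datum the two runs are
EXACTLY gauge equivalent by a periodic unitary gauge (`exists_periodic_gauge_eq_rescale_bavg_flatStratum`), so `Z = 0` is a B8 Landau representative with
all of (1.36)∕(1.38)∕(1.39) trivially and (1.37) by `relPert_zero` ∕ `dbavgCovIter_one_right`. [folklore] -/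
theorem pairLandauGaugeB8Avg_flatStratum [Nonempty n] {L N : ℕ} (hL : 1 ≤ L) (hN : 1 ≤ N) {ε : ℝ} (hε : 0 ≤ ε) (b g β : ℝ)
    {s₁ s₂ : ℝ} (hs₁ : 0 ≤ s₁) (hs₂ : 0 ≤ s₂) :
    PairLandauGaugeB8Avg 4 (sfClass 4 L N ε) L N b g s₁ s₂ β
      {v : Site 4 → Fin 4 → (Matrix n n ℂ)ˣ | IsPeriodicCfg v (N : ℤ) ∧ ∃ w : Site 4 → (Matrix n n ℂ)ˣ,
        IsUnitarySite w ∧ v = gaugeAct w flatCfg} := by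
  rintro k - V ⟨hVP, w, hwu, rfl⟩ UA UB hA hB -
  obtain ⟨u, hu, huP, hrep⟩ := exists_periodic_gauge_eq_rescale_bavg_flatStratum hL hN hε hwu hVP hA hB
  have hξ : 0 ≤ ((L : ℝ)⁻¹) ^ k := pow_nonneg (inv_nonneg.mpr (Nat.cast_nonneg L)) k
  refine ⟨u, fun (_ : Site 4) (_ : Fin 4) => (0 : Matrix n n ℂ), ?_⟩
  exact
    { unitary := hu
      periodic := huP
      skew := fun _ _ => (skewAdjoint _).zero_mem
      per := isPeriodicDir_zero _
      rep := by rw [vary_zero_dir, hrep]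
      landau := isLandauB8_zero L N k _
      sup := fun x κ => by rw [norm_zero]; exact mul_nonneg hs₁ hξ
      grad := fun κ x μ => by
        simp only [Ad, mul_zero, zero_mul, sub_zero, norm_zero]
        exact mul_nonneg hs₁ (pow_nonneg hξ 2)
      holder := fun κ μ y => by
        simp only [Ad, mul_zero, zero_mul, sub_zero, norm_zero]
        exact mul_nonneg hs₂ (Real.rpow_nonneg hξ _)
      lap := fun x κ => by
        rw [covLapDir_zero]
        simp only [norm_zero]
        exact mul_nonneg hs₁ (pow_nonneg hξ 3)
      dbar := by rw [relPert_zero, dbavgCovIter_one_right] }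

/-- **N16 HOLDS ON THE FLAT STRATUM** (`L, N ≥ 1`, `ε ≥ 0`, any `b, g`, every `C, Λ₁, Λ₂′ ≥ 0`): `NE7EtaBackgroundFlatStratum.covRoot_flatStratum` IS the
record decl unfolded (`Z = 0`, energy `0`). [folklore] -/
theorem n16_flatStratum [Nonempty n] {L N : ℕ} (hL : 1 ≤ L) (hN : 1 ≤ N) {ε : ℝ} (hε : 0 ≤ ε) (b g : ℝ) {C Λ₁ Λ₂' : ℝ}
    (hC : 0 ≤ C) (hΛ₁ : 0 ≤ Λ₁) (hΛ₂' : 0 ≤ Λ₂') :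
    NE3EnergyRateWCov 4 (sfClass 4 L N ε) L N b g C Λ₁ Λ₂'
      {v : Site 4 → Fin 4 → (Matrix n n ℂ)ˣ | IsPeriodicCfg v (N : ℤ) ∧ ∃ w : Site 4 → (Matrix n n ℂ)ˣ,
        IsUnitarySite w ∧ v = gaugeAct w flatCfg} :=
  covRoot_flatStratum hL hN hε b g hC hΛ₁ hΛ₂'

/-- **NO BINDER OF THE KNIT IS VACUOUS** (`L, N ≥ 1`; `ε, b′, c′, s₁, s₂, C ≥ 0`): on the flat stratum `FS_N` of `sfClass 4 L N ε` the datum set is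
non-empty (`1 ∈ FS_N`), EVERY datum has a `RegularSup` minimiser at EVERY level (so the `∀ U_A U_B, IsMinimiser … →` prefixes bind something), N05's and
N07's interfaces hold, and so does N16 with the same letters — the knit's hypotheses are jointly satisfiable together with its conclusion. [folklore] -/
theorem inEdges_inhabited_flatStratum [Nonempty n] {L N : ℕ} (hL : 1 ≤ L) (hN : 1 ≤ N) {ε b' c' s₁ s₂ C : ℝ} (hε : 0 ≤ ε)
    (hb' : 0 ≤ b') (hc' : 0 ≤ c') (hs₁ : 0 ≤ s₁) (hs₂ : 0 ≤ s₂) (hC : 0 ≤ C) (b g : ℝ) :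
    (flatCfg : Site 4 → Fin 4 → (Matrix n n ℂ)ˣ) ∈ {v : Site 4 → Fin 4 → (Matrix n n ℂ)ˣ | IsPeriodicCfg v (N : ℤ) ∧
        ∃ w : Site 4 → (Matrix n n ℂ)ˣ, IsUnitarySite w ∧ v = gaugeAct w flatCfg} ∧
    (∀ V ∈ {v : Site 4 → Fin 4 → (Matrix n n ℂ)ˣ | IsPeriodicCfg v (N : ℤ) ∧ ∃ w : Site 4 → (Matrix n n ℂ)ˣ,
        IsUnitarySite w ∧ v = gaugeAct w flatCfg}, ∀ k : ℕ, ∃ U, IsMinimiser 4 (sfClass 4 L N ε) L N k V U ∧ RegularSup 4 L N b' c' k U) ∧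
    PairLandauGaugeB8Avg 4 (sfClass 4 L N ε) L N b g s₁ s₂ 1
      {v : Site 4 → Fin 4 → (Matrix n n ℂ)ˣ | IsPeriodicCfg v (N : ℤ) ∧ ∃ w : Site 4 → (Matrix n n ℂ)ˣ,
        IsUnitarySite w ∧ v = gaugeAct w flatCfg} ∧
    LeafH3sup 4 L N ε b' c'
      {v : Site 4 → Fin 4 → (Matrix n n ℂ)ˣ | IsPeriodicCfg v (N : ℤ) ∧ ∃ w : Site 4 → (Matrix n n ℂ)ˣ,
        IsUnitarySite w ∧ v = gaugeAct w flatCfg} ∧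
    NE3EnergyRateWCov 4 (sfClass 4 L N ε) L N b g C s₁ s₂
      {v : Site 4 → Fin 4 → (Matrix n n ℂ)ˣ | IsPeriodicCfg v (N : ℤ) ∧ ∃ w : Site 4 → (Matrix n n ℂ)ˣ,
        IsUnitarySite w ∧ v = gaugeAct w flatCfg} :=
  ⟨flatCfg_mem_flatStratum N, hmin_flatStratum hL hε hb' hc', pairLandauGaugeB8Avg_flatStratum hL hN hε b g 1 hs₁ hs₂,
    leafH3sup_flatStratum hL hN hε hb' hc', n16_flatStratum hL hN hε b g hC hs₁ hs₂⟩

/-! ## §4 OUT-EDGE N16 → N19 by name -/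

/-- **N16's RECORD DECL IS LITERALLY WHAT NE7 ROUTE #1 (N19) CONSUMES**: `NE3.CovariantRoot.closeness_of_ne3EnergyRateWCov` (p339513) with `hcov := h16`
— at every minimiser pair of level `k ≥ 1`, the gauge `u`, the direction `Z` and the `θ^{13k}` closeness of covariant gradients, curls and plaquette
holonomies, under NE7's own numeric side conditions (`θ⁶ = L⁻¹`, `γ`, `l₁`).  Re-export for the route's K4 → K5 edge; nothing new. [folklore] -/
theorem closeness_of_n16 [Nonempty n] {L N : ℕ} (hL : 2 ≤ L) (hN : 1 ≤ N) {θ : ℝ} (hθ : 0 < θ) (hθ6 : θ ^ 6 = ((L : ℝ))⁻¹)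
    {ε b g C Λ₁ Λ₂' : ℝ} (hb : 0 ≤ b) (hbs : 512 * (4 + 1) * (4 + 4) * (L : ℝ) ^ 2 * b ≤ 1) (hg : 0 ≤ g) (hC : 0 ≤ C) (hΛ₂' : 0 < Λ₂')
    {dom : Set (Site 4 → Fin 4 → (Matrix n n ℂ)ˣ)} (h16 : NE3EnergyRateWCov 4 (sfClass 4 L N ε) L N b g C Λ₁ Λ₂' dom)
    {γ l₁ : ℝ} (hγ : 0 < γ) (hγ3 : C * (wallConst 4 L * (N : ℝ) ^ 2 * (Real.sqrt g * dualC2 4 L + 2 * b ^ 2 * dualC1 4 L)) ≤ γ ^ 3)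
    (hl₁ : 0 < l₁) (hΛl₁ : Λ₁ ≤ l₁ ^ 3) {k : ℕ} (hk : 1 ≤ k) (hfit : γ * (θ ^ k) ^ 2 ≤ l₁ * N)
    {V : Site 4 → Fin 4 → (Matrix n n ℂ)ˣ} (hV : V ∈ dom) {UA UB : Site 4 → Fin 4 → (Matrix n n ℂ)ˣ}
    (hA : IsMinimiser 4 (sfClass 4 L N ε) L N k V UA) (hB : IsMinimiser 4 (sfClass 4 L N ε) L N (k + 1) V UB)
    (hreg : Regular 4 L N b g (k + 1) UB) :
    ∃ (u : Site 4 → (Matrix n n ℂ)ˣ) (Z : Site 4 → Fin 4 → Matrix n n ℂ),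
      IsUnitarySite u ∧ IsPeriodicSite u ((N * L ^ k : ℕ) : ℤ) ∧ IsSkewDir Z ∧ IsPeriodicDir Z ((N * L ^ k : ℕ) : ℤ) ∧
      gaugeAct u UA = vary (rescale L (bavg L UB)) Z 1 ∧
      (∀ (x : Site 4) (κ : Fin 4), ‖Z x κ‖ ≤ 8 * l₁ ^ 2 * γ * θ ^ (8 * k)) ∧
      (∀ (x : Site 4) (μ κ : Fin 4),
        ‖Ad (rescale L (bavg L UB) (x + e κ) μ) (Z (x + e μ) κ) - Z x κ‖ ≤ 4 * l₁ * Real.sqrt (2 * γ * Λ₂') * θ ^ (13 * k)) ∧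
      (∀ (π : T4AveragingDeficitWall.Plane 4) (x : Site 4),
        ‖curl (rescale L (bavg L UB)) Z (x, π)‖ ≤ 8 * l₁ * Real.sqrt (2 * γ * Λ₂') * θ ^ (13 * k)) ∧
      (∀ (z : Site 4) (μ ν : Fin 4),
        ‖((hol (gaugeAct u UA) z (plaqWord μ ν) : (Matrix n n ℂ)ˣ) : Matrix n n ℂ)
            - ((hol (rescale L (bavg L UB)) z (plaqWord μ ν) : (Matrix n n ℂ)ˣ) : Matrix n n ℂ)‖
          ≤ (8 * l₁ * Real.sqrt (2 * γ * Λ₂') + 1536 * l₁ ^ 4 * γ ^ 2 * Real.exp (8 * l₁ ^ 2 * γ)) * θ ^ (13 * k)) :=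
  closeness_of_ne3EnergyRateWCov hL hN hθ hθ6 hb hbs hg hC hΛ₂' h16 hγ hγ3 hl₁ hΛl₁ hk hfit hV hA hB hreg

end

end Summit.QuantumFields.YangMills.BalabanUVNodes.N16
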